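import Literature.NumberTheory.IwasawaTheory.ClassicalMuVanishesImaginaryQuadraticTwoProofs
import Literature.Geometry.Kaehler.ComplexTorusRealMultiplicationNarrowClassNumber
import HarnessLib

/-!
# Unit signatures ONTO: from «totally positive units are squares» (totally real fields), along subfields with the same real embeddings,
# and for the layers `ℚ_n` of the cyclotomic `ℤ₂`-extension of `ℚ` (proved; no definition, no named fact)

`Proofs`-style file (theorems only) in topic `NumberTheory/NumberFields` (namespace `Literature.NumberTheory.NumberFields.UnitSignature`),
written by the prover seat `cruxlead-stmt-BirchSwinnertonDyer-19573-w2` GEN 7 (cell `bsd-2adic`; `--supports` stmt-BirchSwinnertonDyer-19573).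
Input (E5) of the seat's «Iwasawa ℓ = 2 ascent with real places» (`IwasawaTheory.classicalMuVanishes_restrict_of_quadratic_of_signVec_surjective`,
hypothesis `hsig`): the unit signature map `sign : 𝓞_Kˣ → 𝔽₂^{(K ↪ ℝ)}` (`ComplexTorus.signVec`) is ONTO

* `signVec_surjective_of_forall_isSquare` — for a totally real `K` in which every totally positive unit is a square
  (Fröhlich–Taylor V §1 (1.12): `#U⁺/U² · #sign(U) = 2^{[K:ℚ]}`, tree `ComplexTorus.card_totPosUnitsModSq_mul_card_range_signVec`);
* `signVec_surjective_of_comp_injective` — for `A ⊇ M` whenever it is onto for `M` and distinct real embeddings of `A` restrict to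
  distinct real embeddings of `M` (push the unit of `M` up);
* `signVec_surjective_layer_rat_two` — for every layer `ℚ_n` of the cyclotomic `ℤ₂`-extension of `ℚ` (Weber: `h⁺(ℚ_n)` odd, tree
  `IwasawaTheory.odd_classNumber_and_forall_isSquare_layer_two`).

References: [FrohlichTaylor1990] Ch. V §1 (1.10)–(1.13), pp. 163–164; [Washington1997] Thm. 10.4 / §13.1 (ℚ_n); [Lemmermeyer1995] §2 Prop. 1 c)
(units of all signatures ⟺ totally positive units are squares, for totally real fields).
-/

set_option autoImplicit false

noncomputable section

open scoped NumberField Classical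
open NumberField Module

namespace Literature.NumberTheory.NumberFields.UnitSignature

open Literature.Geometry.Kaehler.ComplexTorus Literature.NumberTheory.IwasawaTheory
  Literature.NumberTheory.EllipticCurves Literature.NumberTheory.GaloisRepresentations

/-! ## §1 Totally real fields whose totally positive units are squares -/

/-- **Units of every signature** for a totally real `K` in which every totally positive unit is a square: then `U⁺/U²` is trivial, so
`#sign(U) = 2^{[K:ℚ]} = #𝔽₂^{(K ↪ ℝ)}` (`card_totPosUnitsModSq_mul_card_range_signVec`, `card_realEmbeddings`) and `sign` is onto.
[cite: FrohlichTaylor1990, Ch. V §1 (1.12)–(1.13), p. 164] [cite: Lemmermeyer1995, §2 Prop. 1 c)] -/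
theorem signVec_surjective_of_forall_isSquare {K : Type*} [Field K] [NumberField K] [IsTotallyReal K]
    (h : ∀ u : (𝓞 K)ˣ, (∀ σ : K →+* ℝ, 0 < σ ((u : 𝓞 K) : K)) → IsSquare u) :
    Function.Surjective (signVec (K := K)) := by
  -- `U⁺/U²` is a singleton
  haveI : Subsingleton (TotPosUnitsModSq K) := by
    refine ⟨fun a b ↦ ?_⟩
    induction a using Quot.ind with | _ u => ?_
    induction b using Quot.ind with | _ v => ?_
    rw [totPosUnitsModSq_mk_eq_mk_iff]
    obtain ⟨a, ha⟩ := h u.1 u.2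
    obtain ⟨b, hb⟩ := h v.1 v.2
    refine ⟨a * b⁻¹, ?_⟩
    rw [ha, hb, mul_pow, inv_pow, pow_two, pow_two, mul_assoc, inv_mul_cancel, mul_one]
  have hone : Nat.card (TotPosUnitsModSq K) = 1 := Nat.card_of_subsingleton (Quot.mk _ ⟨1, fun σ ↦ by simp⟩)
  have hcard := card_totPosUnitsModSq_mul_card_range_signVec (K := K)
  rw [hone, one_mul, ← card_realEmbeddings (K := K)] at hcard
  -- the range is everything
  have hfull : Set.range (signVec (K := K)) = Set.univ := by
    refine Set.eq_of_subset_of_ncard_le (Set.subset_univ _) ?_ Set.finite_univ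
    rw [Set.ncard_univ, ← Nat.card_coe_set_eq, hcard, Nat.card_fun, Nat.card_zmod, Nat.card_eq_fintype_card]
  intro f
  have hf : f ∈ Set.range (signVec (K := K)) := by rw [hfull]; exact Set.mem_univ f
  exact hf

/-! ## §2 Going up along an extension with the same real embeddings -/

/-- **Signatures onto go up**: `M ⊆ A` number fields such that distinct real embeddings of `A` restrict to distinct real embeddings of `M`;
if the unit signature map of `M` is onto, so is that of `A` (the unit of `M` with the required signs at the restrictions serves).
[cite: FrohlichTaylor1990, Ch. V §1 (1.12), p. 164] -/
theorem signVec_surjective_of_comp_injective {M A : Type*} [Field M] [NumberField M] [Field A] [NumberField A] [Algebra M A]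
    (hinj : Function.Injective fun ρ : A →+* ℝ ↦ ρ.comp (algebraMap M A))
    (hM : Function.Surjective (signVec (K := M))) :
    Function.Surjective (signVec (K := A)) := by
  intro f
  -- the target signs, read on `M`
  let g : (M →+* ℝ) → ZMod 2 := fun τ ↦
    if hτ : ∃ ρ : A →+* ℝ, ρ.comp (algebraMap M A) = τ then f hτ.choose else 0
  obtain ⟨u, hu⟩ := hM g
  refine ⟨Units.map (algebraMap (𝓞 M) (𝓞 A) : 𝓞 M →* 𝓞 A) u, funext fun ρ ↦ ?_⟩
  have hτ : ∃ ρ' : A →+* ℝ, ρ'.comp (algebraMap M A) = ρ.comp (algebraMap M A) := ⟨ρ, rfl⟩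
  have hchoose : hτ.choose = ρ := hinj hτ.choose_spec
  have hval : ((Units.map (algebraMap (𝓞 M) (𝓞 A) : 𝓞 M →* 𝓞 A) u : 𝓞 A) : A) =
      algebraMap M A ((u : 𝓞 M) : M) := by
    change algebraMap (𝓞 A) A (algebraMap (𝓞 M) (𝓞 A) (u : 𝓞 M)) = algebraMap M A (algebraMap (𝓞 M) M (u : 𝓞 M))
    rw [← IsScalarTower.algebraMap_apply, ← IsScalarTower.algebraMap_apply]
  rw [signVec_apply, hval, ← RingHom.comp_apply, ← signVec_apply u (ρ.comp (algebraMap M A)), hu]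
  change (if hτ' : ∃ ρ' : A →+* ℝ, ρ'.comp (algebraMap M A) = ρ.comp (algebraMap M A) then f hτ'.choose else 0) = f ρ
  rw [dif_pos hτ, hchoose]

/-! ## §3 The layers `ℚ_n` of the cyclotomic `ℤ₂`-extension of `ℚ` -/

/-- **Units of every signature in `ℚ_n`** (the `n`-th layer of the cyclotomic `ℤ₂`-extension of `ℚ`, `ℚ_n = ℚ(ζ_{2^{n+2}})⁺`): Weber's
theorem makes `h⁺(ℚ_n)` odd, so the totally positive units of the totally real `ℚ_n` are squares (tree
`IwasawaTheory.odd_classNumber_and_forall_isSquare_layer_two`), and §1 applies. [cite: Washington1997, Thm. 10.4 and §13.1]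
[cite: FrohlichTaylor1990, Ch. V §1 (1.12), p. 164] -/
theorem signVec_surjective_layer_rat_two (κ : ZpExtension ℚ 2) (hκ : κ.IsCyclotomic) (n : ℕ) :
    (haveI : FiniteDimensional ℚ ↥(κ.layer n) := κ.finiteDimensional_layer_holds n
     haveI : NumberField ↥(κ.layer n) := NumberField.of_module_finite ℚ _
     Function.Surjective (signVec (K := ↥(κ.layer n)))) := by
  haveI : Fact (Nat.Prime 2) := ⟨Nat.prime_two⟩
  haveI : FiniteDimensional ℚ ↥(κ.layer n) := κ.finiteDimensional_layer_holds n
  haveI : NumberField ↥(κ.layer n) := NumberField.of_module_finite ℚ _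
  haveI : IsTotallyReal ↥(κ.layer n) := isTotallyReal_layer_rat κ n
  exact signVec_surjective_of_forall_isSquare (odd_classNumber_and_forall_isSquare_layer_two hκ n).2

end Literature.NumberTheory.NumberFields.UnitSignature

end
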